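import Mathlib.Analysis.Normed.Unbundled.SpectralNorm
import Mathlib.Analysis.Normed.Module.FiniteDimension
import Mathlib.NumberTheory.Padics.ProperSpace
import Literature.AlgebraicGeometry.Motives.AlgPointsProductProofs
import Literature.AlgebraicGeometry.Motives.AlgPointsTotallyDisconnectedProofs
import Literature.AnabelianGeometry.AbsoluteAnabelian.AbsTopIII.KummerFaithfulStrongTopologyProofs
import Literature.AnabelianGeometry.AbsoluteAnabelian.AbsTopIII.KummerFaithfulPadicProofs
import Literature.AnabelianGeometry.AbsoluteAnabelian.AbsTopIII.KummerFaithfulSubpadicProofs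
import HarnessLib

/-!
# [AbsTopIII] Rmk. 1.5.4 (i) for MLFs, UNCONDITIONALLY: `p`-adic fields are Kummer-faithful
# (proof-only companion of `KummerFaithful.lean`)

Mochizuki, *Topics in Absolute Anabelian Geometry III*, §1, Def. 1.5 p. 32 and Rmk. 1.5.4 (i) p. 33
("every sub-`p`-adic field `k` [...] is Kummer-faithful [...] if `k`, hence also `k_H`, is a finite
extension of `ℚ_p`, then `A(k_H)` is an extension of a finitely generated `ℤ`-module by a compact
abelian `p`-adic Lie group [...]. In particular, the condition of Definition 1.5, (a), is satisfied"),
manuscript pagination (lit key `paper:url-5493eb38cbb7`).  Cell abc-iut, FACT-LIST row **F-0369**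
`Rmk_1_5_4_i` (abc-iut-f-085, F fact-proving wave): the **MLF case of the row is hereby a theorem**,
and the tree acquires its FIRST KERNEL-CERTIFIED KUMMER-FAITHFUL FIELDS (`ℚ_p` and all its finite
extensions), so that every "refuted modulo F-0369" universal closure of the campaign becomes refuted
outright.

The abelian-variety clause of Def. 1.5 (a) — `⋂_N N·A(K) = 0` for every abelian variety over every
finite extension `K` of the field — is obtained WITHOUT Mattuck's structure theorem, from the point-set
topology of the strong topology on `A(K)` (all inputs PROVED in the tree):

* `A(K)` is compact (`Literature.AlgebraicGeometry.Motives.compactSpace_algPoints_of_isProper_holds`,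
  valuative criterion; Mumford *Red Book* I.10 Thm. 2 / Conrad §5), Hausdorff (`t2Space_algPoints_holds`)
  and totally disconnected (`totallyDisconnectedSpace_algPoints`) — packaged as
  `compactSpace_t2Space_totallyDisconnectedSpace_algPoints_of_isProper`;
* `(A ×ₖ A)(K) ≃ A(K) × A(K)` is a homeomorphism (`AlgPoints.isHomeomorph_prodEquiv_holds`, Conrad
  Prop. 2.1), so `A(K)` is a topological group
  (`AbelianVariety.isTopologicalGroup_points_of_isHomeomorph_prodEquiv`);
* a profinite group has no divisible elements (`DivisibleElementsTrivial.of_profinite`,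
  `KummerFaithfulProfiniteProofs.lean`), assembled in
  `AbelianVariety.divisibleElementsTrivial_points_of_compactSpace` (`KummerFaithfulStrongTopologyProofs.lean`);
* a finite extension `K` of `ℚ_p` is a locally compact, ultrametric, non-trivially normed field for the
  spectral norm (Mathlib `spectralNorm.nontriviallyNormedField`, `FiniteDimensional.proper`).

Results: `AbelianVariety.divisibleElementsTrivial_points_of_locallyCompactSpace` (any abelian variety
over any `k`, points in any totally disconnected locally compact non-trivially normed `L ⊇ k`),
`AbelianVariety.divisibleElementsTrivial_points_of_finite_padic`, **`isKummerFaithful_of_finite_padic`**,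
**`isKummerFaithful_padic`**, **`IsMLF.isKummerFaithful`**, `Rmk_1_5_4_i_of_isMLF` (the printed
reduction's terminal case "`k` itself is an MLF"), `exists_isKummerFaithful`.  The torus half is the
tree's `isTorallyKummerFaithful_of_finite_padic` (`KummerFaithfulPadicProofs.lean`).

HONEST SCOPE.  `Rmk_1_5_4_i` as typed quantifies over ALL sub-`p`-adic fields (subfields of finitely
generated extensions of `ℚ_p`, e.g. `ℚ_p(t)`); the general case needs the Lang–Néron / specialisation
step of the printed proof and is NOT proved here — the row stays a named fact, with its MLF instances
discharged.  `IsKummerFaithful` is the tree's typing (tori + abelian varieties), implied by the printed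
definition.  Nothing here bears on [IUTchIII] Cor. 3.12.
-/

noncomputable section

namespace Literature.AnabelianGeometry.AbsoluteAnabelian.AbsTopIII

universe u

open Literature.AlgebraicGeometry.Motives

/-! ### Def. 1.5 (a) for abelian varieties over totally disconnected local fields -/

/-- **`⋂_N A(L)^N = {1}` for an abelian variety `A/k` and a totally disconnected, locally compact,
non-trivially normed field `L ⊇ k`** (e.g. any finite extension of `ℚ_p` containing `k`): `A(L)` is a
profinite group in the strong topology (compact: `compactSpace_algPoints_of_isProper_holds`; Hausdorff;
totally disconnected; topological group: `isHomeomorph_prodEquiv_holds`), and profinite groups have no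
divisible elements.  Unconditional. [cite: MochizukiAbsTopIII2015, Rmk 1.5.4 (i) p.33] -/
theorem AbelianVariety.divisibleElementsTrivial_points_of_locallyCompactSpace {k : Type u} [Field k]
    (A : AbelianVariety k) (L : Type u) [NontriviallyNormedField L] [Algebra k L]
    [LocallyCompactSpace L] [TotallyDisconnectedSpace L] :
    DivisibleElementsTrivial (A.Points L) := by
  obtain ⟨hc, -, -⟩ := compactSpace_t2Space_totallyDisconnectedSpace_algPoints_of_isProper A.X L
  exact AbelianVariety.divisibleElementsTrivial_points_of_compactSpace A L
    AlgPoints.isHomeomorph_prodEquiv_holds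

/-- The same over an **ultrametric** locally compact non-trivially normed field `L ⊇ k` (an
ultrametric space is totally disconnected). [cite: MochizukiAbsTopIII2015, Rmk 1.5.4 (i) p.33] -/
theorem AbelianVariety.divisibleElementsTrivial_points_of_isUltrametricDist {k : Type u} [Field k]
    (A : AbelianVariety k) (L : Type u) [NontriviallyNormedField L] [IsUltrametricDist L]
    [Algebra k L] [LocallyCompactSpace L] : DivisibleElementsTrivial (A.Points L) :=
  AbelianVariety.divisibleElementsTrivial_points_of_locallyCompactSpace A L

/-- **`⋂_N A(K)^N = {1}` for an abelian variety `A/k` and a finite extension `K` of `ℚ_p` containing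
`k`** ("`A(k_H)` is an extension of a finitely generated `ℤ`-module by a compact abelian `p`-adic Lie
group [...] In particular, the condition of Definition 1.5, (a), is satisfied", Rmk. 1.5.4 (i) p. 33):
`K` is a locally compact ultrametric non-trivially normed field for the spectral norm extending `|·|_p`
(Mathlib `spectralNorm.nontriviallyNormedField`, `FiniteDimensional.proper`), and the previous theorem
applies.  Unconditional; Mattuck's theorem is not used. [cite: MochizukiAbsTopIII2015, Rmk 1.5.4 (i) p.33] -/
theorem AbelianVariety.divisibleElementsTrivial_points_of_finite_padic (p : ℕ) [Fact p.Prime]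
    {k : Type u} [Field k] (A : AbelianVariety k) (K : Type u) [Field K] [Algebra k K]
    [Algebra ℚ_[p] K] [FiniteDimensional ℚ_[p] K] : DivisibleElementsTrivial (A.Points K) := by
  haveI : Algebra.IsAlgebraic ℚ_[p] K := Algebra.IsAlgebraic.of_finite ℚ_[p] K
  letI : NontriviallyNormedField K := spectralNorm.nontriviallyNormedField ℚ_[p] K
  haveI : IsUltrametricDist K :=
    IsUltrametricDist.isUltrametricDist_of_isNonarchimedean_norm isNonarchimedean_spectralNorm
  haveI : LocallyCompactSpace K := by
    letI : NormedAddCommGroup K := spectralNorm.normedAddCommGroup ℚ_[p] K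
    letI : NormedSpace ℚ_[p] K := spectralNorm.normedSpace ℚ_[p] K
    haveI : ProperSpace K := FiniteDimensional.proper ℚ_[p] K
    exact inferInstanceAs (LocallyCompactSpace K)
  exact AbelianVariety.divisibleElementsTrivial_points_of_isUltrametricDist A K

/-! ### `p`-adic fields are Kummer-faithful -/

/-- **Every finite extension `F` of `ℚ_p` (every MLF) is Kummer-faithful** ([AbsTopIII] Rmk. 1.5.4
(i) p. 33, case "`k` itself is an MLF"): the torus half is `isTorallyKummerFaithful_of_finite_padic`,
and for a finite extension `k′/F` (again finite over `ℚ_p`) and an abelian variety `A/k′`,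
`⋂_N A(k′)^N = {1}` by `AbelianVariety.divisibleElementsTrivial_points_of_finite_padic`.  Unconditional.
[cite: MochizukiAbsTopIII2015, Rmk 1.5.4 (i) p.33] -/
theorem isKummerFaithful_of_finite_padic (p : ℕ) [Fact p.Prime] (F : Type u) [Field F]
    [Algebra ℚ_[p] F] [FiniteDimensional ℚ_[p] F] : IsKummerFaithful F := by
  refine ⟨isTorallyKummerFaithful_of_finite_padic p F, fun k' _ _ hfin A => ?_⟩
  haveI := hfin
  letI : Algebra ℚ_[p] k' := ((algebraMap F k').comp (algebraMap ℚ_[p] F)).toAlgebra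
  haveI : IsScalarTower ℚ_[p] F k' := IsScalarTower.of_algebraMap_eq (fun _ => rfl)
  haveI : FiniteDimensional ℚ_[p] k' := Module.Finite.trans F k'
  exact AbelianVariety.divisibleElementsTrivial_points_of_finite_padic p A k'

/-- **`ℚ_p` is Kummer-faithful** ([AbsTopIII] Def. 1.5 p. 32 / Rmk. 1.5.4 (i) p. 33).  Unconditional.
[cite: MochizukiAbsTopIII2015, Rmk 1.5.4 (i) p.33] -/
theorem isKummerFaithful_padic (p : ℕ) [Fact p.Prime] : IsKummerFaithful ℚ_[p] :=
  isKummerFaithful_of_finite_padic p ℚ_[p]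

/-- **Every MLF is Kummer-faithful** (the cell's `IsMLF`: a finite extension of some `ℚ_p`;
[AbsTopIII] Rmk. 1.5.4 (i) p. 33, case "`k` itself is an MLF").  Unconditional.
[cite: MochizukiAbsTopIII2015, Rmk 1.5.4 (i) p.33] -/
theorem _root_.Literature.AnabelianGeometry.AbsoluteAnabelian.IsMLF.isKummerFaithful
    {K : Type u} [Field K] (h : IsMLF K) : IsKummerFaithful K := by
  obtain ⟨p, hp, f, hf⟩ := h.exists_padic
  letI : Algebra ℚ_[p] K := f.toAlgebra
  haveI : Module.Finite ℚ_[p] K := hf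
  exact isKummerFaithful_of_finite_padic p K

/-- **[AbsTopIII] Rmk. 1.5.4 (i), MLF case** — the terminal case of the printed reduction ("one
reduces immediately [...] to the case where `k` itself is an MLF"), now a theorem: every MLF is
Kummer-faithful.  The general sub-`p`-adic case (`Rmk_1_5_4_i`, FACT-LIST F-0369) additionally needs the
specialisation / Lang–Néron step and stays a named fact. [cite: MochizukiAbsTopIII2015, Rmk 1.5.4 (i) p.33] -/
theorem Rmk_1_5_4_i_of_isMLF : ∀ (k : Type u) [Field k], IsMLF k → IsKummerFaithful k :=
  fun _ _ h => h.isKummerFaithful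

/-- **A Kummer-faithful field exists** (in every universe): `ℚ_2`, lifted.  Hence the campaign's
kernel classifications of the form «(∀ M, P M) ↔ ∀ k, ¬ IsKummerFaithful k» now read «¬ ∀ M, P M».
[cite: MochizukiAbsTopIII2015, Rmk 1.5.4 (i) p.33] -/
theorem exists_isKummerFaithful : ∃ (k : Type) (_ : Field k), IsKummerFaithful k :=
  haveI : Fact (Nat.Prime 2) := ⟨Nat.prime_two⟩
  ⟨ℚ_[2], inferInstance, isKummerFaithful_padic 2⟩

/-- `IsSubpadic k → IsKummerFaithful k` holds for every MLF `k` — the instance form of F-0369 consumed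
by the [AbsTopIII] §1 Kummer chain at `p`-adic base fields (`IsSubpadic.of_isMLF`).
[cite: MochizukiAbsTopIII2015, Rmk 1.5.4 (i) p.33] -/
theorem isKummerFaithful_of_isSubpadic_of_isMLF {k : Type u} [Field k] (hMLF : IsMLF k)
    (_h : IsSubpadic k) : IsKummerFaithful k :=
  hMLF.isKummerFaithful

end Literature.AnabelianGeometry.AbsoluteAnabelian.AbsTopIII

end
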